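import Mathlib
import HarnessLib
import Summits.NavierStokesRegularity.NavierStokesRegularity.Theorems.PoloidalWindowDoorLrcModEntireQ4CurvedVerticalEntrance
import Summits.NavierStokesRegularity.NavierStokesRegularity.Theorems.PoloidalWindowDoorLrcModEntireQ4CurvedVerticalOrderOne
import Summits.NavierStokesRegularity.NavierStokesRegularity.Theorems.PoloidalWindowDoorLrcModEntireCurvedTowerSheetForm

/-!
# Route `PoloidalWindowDoor`, item `LrcModEntire` (stmt-NavierStokesRegularity-20428), cell (Q4-curved), v16 child «VERTICAL» —
# ORDER 1 IN WEB CURRENCY: over a vertical critical sheet the time web moves with the `z`-FREE speed `b(s) = Uₕ·ν` (VERT-PROP-g18 §3)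

Cell ns-regularity-ideate, helper seat ns-k2-port-2 g9 under the LEAD of item 20428 (ns-poloidal-K2-p3 g18, P3 offered 2026-08-30T02:30Z);
`--supports stmt-NavierStokesRegularity-20428 --as helper`.  PACKAGE CURRENCY (as `…Q4CurvedVerticalEntrance.vertical_entrance`): class data, the branch `Γ`
(now with its Frenet law for the clause's `k`, as exported by K2-p2 g18's `curved_time_web_package`), `μ ∈ C³`, the `∀ q`-clause of `curved_time_web_package`
VERBATIM, and (V0).

★★ `vertical_web_speed` — there is `δ₁ ∈ (0, δ′]` such that for every `s` and every height `|z| < δ₁`, `|z| < ρ` with `μ(−1,z) ≠ 0`: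
`∂_τ n₀(0, s, z) = ⟪U(−1)(Γ s), JΓ′(s)⟫` — the speed of the time web through the vertical cylinder is the normal component of the horizontal velocity ON
THE BRANCH, independent of the height.  Proof: `vertical_entrance` (E0) puts the web point at the centre `Γ s + z·e₂`; the space–time criticality of the web
(`…CurvedTowerSheetForm.hkin_of_criticality`) gives the kinematic identity; B-SPEEDc `…CurvedSheetSpeedLaw.curved_sheet_speed_law` with offset `d ≡ 0` turns it
into `V·D²θ[ν,ν] = −(1−μ)(D³θ[ν,ν,ν] − k·D²θ[ν,ν]) + D²θ[ν,ν]·(Uₕ·ν)`; the bracket vanishes by `…Q4CurvedVerticalOrderOne.vertical_cylinder_jets`;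
`D²θ[ν,ν] ≠ 0` by the ridge law at the centre (E4) with `D²θ[T,T] = 0`; and `Uₕ·ν` is `z`-free on the cylinder by (E3) (`∂_zUₕ = 0`, integration along the
vertical segment, `IsOpen.is_const_of_deriv_eq_zero`).

WHAT THIS IS NOT: not a claim about Navier–Stokes regularity; closes nothing (kernel brick for the RESEARCH slot `stub_Q4curvedAperiodicVertical`, VERT-PROP
ORDER 1); items 20428 / 19708 / 27893 OPEN (bears_on LADDER-NS N0).
-/

noncomputable section

set_option linter.dupNamespace false
set_option linter.style.longLine false

namespace Summit.NavierStokesRegularity.NavierStokesRegularity.Theorems.PoloidalWindowDoorLrcModEntireQ4CurvedVerticalWebSpeed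

open Set Function Filter Topology Metric
open scoped RealInnerProductSpace InnerProductSpace Laplacian ContDiff
open Literature.Analysis Literature.Analysis.FluidPDE Literature.Analysis.UnboundedOperators
open Summit.NavierStokesRegularity.NavierStokesRegularity.Theorems
open Summit.NavierStokesRegularity.NavierStokesRegularity.Theorems.LocalSineTubeDoorProfileAlignedWindowRigidityAncient
open Summit.NavierStokesRegularity.NavierStokesRegularity.Theorems.PoloidalWindowDoorLrcModEntireSheetFlattenTools
open Summit.NavierStokesRegularity.NavierStokesRegularity.Theorems.PoloidalWindowDoorLrcModEntireRidgeGlobalBranchODE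
open Summit.NavierStokesRegularity.NavierStokesRegularity.Theorems.PoloidalWindowDoorLrcModEntireRidgeGlobalBranchFrame
open Summit.NavierStokesRegularity.NavierStokesRegularity.Theorems.PoloidalWindowDoorLrcModEntirePlanarCurveRigidity
open Summit.NavierStokesRegularity.NavierStokesRegularity.Theorems.PoloidalWindowDoorLrcModEntireRidgeClassConstants
open Summit.NavierStokesRegularity.NavierStokesRegularity.Theorems.PoloidalWindowDoorLrcModEntireQ4TimeWebFunction
open Summit.NavierStokesRegularity.NavierStokesRegularity.Theorems.PoloidalWindowDoorLrcModEntireQ4SonicHotSheetSecondPins (fderiv_fderiv_const_mul_apply)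
open Summit.NavierStokesRegularity.NavierStokesRegularity.Theorems.PoloidalWindowDoorLrcModEntireCurvedSheetSpeedLaw
open Summit.NavierStokesRegularity.NavierStokesRegularity.Theorems.PoloidalWindowDoorLrcModEntireCurvedTowerSheetForm
open Summit.NavierStokesRegularity.NavierStokesRegularity.Theorems.PoloidalWindowDoorLrcModEntireQ4CurvedVerticalEntrance
open Summit.NavierStokesRegularity.NavierStokesRegularity.Theorems.PoloidalWindowDoorLrcModEntireQ4CurvedVerticalOrderOne

variable {C : ℝ} {U : ℝ → EuclideanSpace ℝ (Fin 3) → EuclideanSpace ℝ (Fin 3)}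

/-- ★★ **THE TIME WEB THROUGH A VERTICAL CRITICAL SHEET MOVES WITH THE `z`-FREE SPEED `Uₕ·ν` (VERT-PROP ORDER 1, web currency).**  See the module docstring. -/
theorem vertical_web_speed
    (hrate : HasTypeITimeDecay C U) (hcont : ContinuousOn (uncurry U) (Iio (0 : ℝ) ×ˢ univ))
    (hmild : ∀ s t : ℝ, s < t → t < 0 → ∀ x, U t x = heatExtension (U s) (t - s) x - oseenDuhamel 1 s U U t x)
    (hdiv : ∀ t < 0, VectorCalculus.IsDivFree (U t))
    (hpol : ∀ s < 0, ∀ y, ⟪curl (U s) y, EuclideanSpace.single 2 1⟫_ℝ = 0)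
    {σ ρ r δ' : ℝ} {μ R κt : ℝ → ℝ → ℝ} {n₀ : ℝ × ℝ × ℝ → ℝ} {k : ℝ → ℝ} {Γ : ℝ → EuclideanSpace ℝ (Fin 3)}
    (hρ : 0 < ρ)
    (hslabU : ∀ t : ℝ, |t + 1| < ρ → ∀ x : EuclideanSpace ℝ (Fin 3), |x 2| < ρ → ∀ b : Fin 3, b ≠ 2 →
      fderiv ℝ (U t) x (EuclideanSpace.single 2 1) b = μ t (x 2) * fderiv ℝ (U t) x (EuclideanSpace.single b 1) 2)
    (hσ : σ = 1 ∨ σ = -1) (hΓ : ContDiff ℝ ∞ Γ) (hΓ2 : ∀ s, Γ s 2 = 0) (hΓunit : ∀ s, ‖deriv Γ s‖ = 1) (hr : 0 < r) (hδ' : 0 < δ')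
    (hq : ∀ q : ℝ × ℝ × ℝ, |q.1| < δ' → |q.2.2| < δ' →
        n₀ q ∈ Ioo (-r) r ∧
        σ * U (-1 + q.1) (Γ q.2.1 + n₀ q • rotJ (deriv Γ q.2.1) + q.2.2 • e2) 2 = R q.1 q.2.2 ∧
        (∀ n ∈ Icc (-r) r, n ≠ n₀ q → σ * U (-1 + q.1) (Γ q.2.1 + n • rotJ (deriv Γ q.2.1) + q.2.2 • e2) 2 < R q.1 q.2.2) ∧
        (∀ w : EuclideanSpace ℝ (Fin 3), w 2 = 0 → fderiv ℝ (fun y => U (-1 + q.1) y 2) (Γ q.2.1 + n₀ q • rotJ (deriv Γ q.2.1) + q.2.2 • e2) w = 0) ∧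
        (∀ m : ℕ∞, ContDiffAt ℝ m n₀ q) ∧
        0 < κt q.1 q.2.2 ∧ μ (-1 + q.1) q.2.2 < 1 ∧
        fderiv ℝ (fderiv ℝ (fun y => σ * U (-1 + q.1) y 2)) (Γ q.2.1 + n₀ q • rotJ (deriv Γ q.2.1) + q.2.2 • e2) (deriv Γ q.2.1) (deriv Γ q.2.1) +
            fderiv ℝ (fderiv ℝ (fun y => σ * U (-1 + q.1) y 2)) (Γ q.2.1 + n₀ q • rotJ (deriv Γ q.2.1) + q.2.2 • e2)
              (rotJ (deriv Γ q.2.1)) (rotJ (deriv Γ q.2.1)) = -κt q.1 q.2.2 ∧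
        fderiv ℝ (fderiv ℝ (fun y => σ * U (-1 + q.1) y 2)) (Γ q.2.1 + n₀ q • rotJ (deriv Γ q.2.1) + q.2.2 • e2) e2 e2 =
          -μ (-1 + q.1) q.2.2 *
            (fderiv ℝ (fderiv ℝ (fun y => σ * U (-1 + q.1) y 2)) (Γ q.2.1 + n₀ q • rotJ (deriv Γ q.2.1) + q.2.2 • e2) (deriv Γ q.2.1) (deriv Γ q.2.1) +
              fderiv ℝ (fderiv ℝ (fun y => σ * U (-1 + q.1) y 2)) (Γ q.2.1 + n₀ q • rotJ (deriv Γ q.2.1) + q.2.2 • e2)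
                (rotJ (deriv Γ q.2.1)) (rotJ (deriv Γ q.2.1))) ∧
        κt q.1 q.2.2 * (1 - k q.2.1 * n₀ q) ^ 2 * (fderiv ℝ n₀ q ((0 : ℝ), (0 : ℝ), (1 : ℝ))) ^ 2 =
          (deriv (deriv (R q.1)) q.2.2 - μ (-1 + q.1) q.2.2 * κt q.1 q.2.2) *
            ((1 - k q.2.1 * n₀ q) ^ 2 + (fderiv ℝ n₀ q ((0 : ℝ), (1 : ℝ), (0 : ℝ))) ^ 2))
    (hV0 : ∃ δᵥ : ℝ, 0 < δᵥ ∧ ∀ s z : ℝ, |z| < δᵥ → σ * U (-1) (Γ s + z • EuclideanSpace.single 2 (1 : ℝ)) 2 = R 0 z)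
    (hμ3 : ContDiff ℝ 3 (uncurry μ)) (hk : ∀ s, deriv (deriv Γ) s = k s • rotJ (deriv Γ s)) :
    ∃ δ₁ : ℝ, 0 < δ₁ ∧ δ₁ ≤ δ' ∧ ∀ s z : ℝ, |z| < δ₁ → |z| < ρ → μ (-1) z ≠ 0 →
      fderiv ℝ n₀ ((0 : ℝ), s, z) ((1 : ℝ), (0 : ℝ), (0 : ℝ)) = ⟪U (-1) (Γ s), rotJ (deriv Γ s)⟫ := by
  obtain ⟨δ₁, hδ₁, hδ₁', hE0, hE1, -, hE3, -, hE4, -⟩ :=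
    vertical_entrance hrate hcont hmild hdiv hpol hρ hslabU hσ hΓ hΓ2 hΓunit hr hδ' hq hV0
  refine ⟨δ₁, hδ₁, hδ₁', fun s z hz hzρ hμ0 => ?_⟩
  have hm1 : (-1 : ℝ) < 0 := by norm_num
  have hσ0 : σ ≠ 0 := by rcases hσ with h | h <;> rw [h] <;> norm_num
  have h0δ' : |(0 : ℝ)| < δ' := by simpa using hδ'
  have hzδ' : |z| < δ' := lt_of_lt_of_le hz hδ₁'
  have hΓc2 : ContDiff ℝ 2 Γ := hΓ.of_le (by norm_cast)
  have hT2 : ∀ s, deriv Γ s 2 = 0 := fun s => (deriv_horizontal hΓc2 hΓ2 s).1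
  have hν2 : ∀ s, rotJ (deriv Γ s) 2 = 0 := fun s => (rotJ_apply _).2.2
  have hUan : AnalyticOnNhd ℝ (U (-1)) univ := analyticOnNhd_slice hcont (bdd_of_hasTypeITimeDecay hrate) hmild hm1
  have hUd : Differentiable ℝ (U (-1)) := fun x => (hUan x (mem_univ _)).differentiableAt
  have hθan : AnalyticOnNhd ℝ (fun y => U (-1) y 2) univ := fun x _ =>
    ((EuclideanSpace.proj (𝕜 := ℝ) (2 : Fin 3)).analyticAt _).comp (hUan x (mem_univ _))
  have hθ2 : ContDiff ℝ 2 (fun y => U (-1) y 2) := hθan.contDiff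
  -- the package at `(0, s, z)` and the web point = centre
  obtain ⟨-, -, -, hcrit0, hsmooth, hκt, hμ1, h8, -, -⟩ := hq ((0 : ℝ), s, z) h0δ' hzδ'
  simp only [add_zero] at hcrit0 hsmooth hκt hμ1 h8
  have hn0 : n₀ ((0 : ℝ), s, z) = 0 := hE0 s z hz
  rw [hn0, zero_smul, add_zero] at h8
  /- STEP 1: the kinematic identity of the time web at the cylinder point (criticality at all nearby times) -/
  have hcritE : ∀ s' z' : ℝ, |z'| < ρ → ∀ w : EuclideanSpace ℝ (Fin 3), w 2 = 0 → fderiv ℝ (fun y => U (-1) y 2) (Γ s' + z' • e2) w = 0 :=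
    fun s' z' _ w hw => hE1 s' z' w hw
  have hF2u : ContDiffAt ℝ 2 (uncurry fun a y => σ * U (-1 + a) y 2) ((0 : ℝ), Γ s + z • e2) := by
    have h := contDiffOn_uncurry_signed hrate hcont hmild hdiv σ (n := 2) (T := Ioo (-1 / 2) (1 / 2)) Subset.rfl
    exact h.contDiffAt ((isOpen_Ioo.prod isOpen_univ).mem_nhds ⟨⟨by norm_num, by norm_num⟩, mem_univ _⟩)
  have hlτ : HasDerivAt (fun τ : ℝ => ((τ, s, z) : ℝ × ℝ × ℝ)) ((1 : ℝ), (0 : ℝ), (0 : ℝ)) 0 :=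
    ((hasDerivAt_id (0 : ℝ)).prodMk (hasDerivAt_const (0 : ℝ) (s, z))).congr_deriv rfl
  have hndiff : DifferentiableAt ℝ n₀ ((0 : ℝ), s, z) := (hsmooth 1).differentiableAt (by simp)
  have hg : HasDerivAt (fun τ : ℝ => n₀ (τ, s, z)) (fderiv ℝ n₀ ((0 : ℝ), s, z) ((1 : ℝ), (0 : ℝ), (0 : ℝ))) 0 :=
    hndiff.hasFDerivAt.comp_hasDerivAt (0 : ℝ) hlτ
  have hPd : HasDerivAt (fun τ : ℝ => Γ s + n₀ (τ, s, z) • rotJ (deriv Γ s) + z • e2)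
      (fderiv ℝ n₀ ((0 : ℝ), s, z) ((1 : ℝ), (0 : ℝ), (0 : ℝ)) • rotJ (deriv Γ s)) 0 :=
    ((hg.smul_const (rotJ (deriv Γ s))).const_add (Γ s)).add_const (z • e2)
  have hP0 : (fun τ : ℝ => Γ s + n₀ (τ, s, z) • rotJ (deriv Γ s) + z • e2) 0 = Γ s + z • e2 := by
    simp only [hn0, zero_smul, add_zero]
  have hcrit : ∀ᶠ τ in 𝓝 (0 : ℝ), fderiv ℝ (fun y => (uncurry fun a y => σ * U (-1 + a) y 2) (τ, y))
      ((fun τ : ℝ => Γ s + n₀ (τ, s, z) • rotJ (deriv Γ s) + z • e2) τ) (rotJ (deriv Γ s)) = 0 := by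
    have hmem : Ioo (-min δ' (1 / 2)) (min δ' (1 / 2)) ∈ 𝓝 (0 : ℝ) :=
      isOpen_Ioo.mem_nhds ⟨by simp [hδ'], by simp [hδ']⟩
    filter_upwards [hmem] with τ hτ
    have hτδ : |τ| < δ' := abs_lt.2 ⟨by linarith [hτ.1, min_le_left δ' (1 / 2)], by linarith [hτ.2, min_le_left δ' (1 / 2)]⟩
    have hτh : |τ| < 1 / 2 := abs_lt.2 ⟨by linarith [hτ.1, min_le_right δ' (1 / 2)], by linarith [hτ.2, min_le_right δ' (1 / 2)]⟩
    have hc := (hq (τ, s, z) hτδ hzδ').2.2.2.1 (rotJ (deriv Γ s)) (hν2 s)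
    have hθτ : Differentiable ℝ (fun y => U (-1 + τ) y 2) := (contDiff_two_vert_at hrate hcont hmild hdiv hτh).differentiable (by norm_num)
    show fderiv ℝ (fun y => σ * U (-1 + τ) y 2) (Γ s + n₀ (τ, s, z) • rotJ (deriv Γ s) + z • e2) (rotJ (deriv Γ s)) = 0
    rw [show (fun y => σ * U (-1 + τ) y 2) = fun y => σ * (fun y' => U (-1 + τ) y' 2) y from rfl, fderiv_const_mul (hθτ _) σ]
    simp [hc]
  have hkin := hkin_of_criticality hF2u hP0 hPd hcrit
  /- STEP 2: the speed law with `d ≡ 0` and the vertical jets -/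
  have hIρ : ∀ z' ∈ Ioo (-ρ) ρ, |z'| < ρ := fun z' hz' => abs_lt.2 ⟨hz'.1, hz'.2⟩
  have hzI : z ∈ Ioo (-ρ) ρ := ⟨(abs_lt.1 hzρ).1, (abs_lt.1 hzρ).2⟩
  have hJ : ∀ s' : ℝ, ∀ z' ∈ Ioo (-ρ) ρ, 1 - k s' * (fun _ : ℝ => (0 : ℝ)) z' ≠ 0 := fun s' z' _ => by simp
  have hν0 : ∀ s' : ℝ, ∀ z' ∈ Ioo (-ρ) ρ,
      fderiv ℝ (fun y => U (-1 + 0) y 2) (Γ s' + (fun _ : ℝ => (0 : ℝ)) z' • rotJ (deriv Γ s') + z' • e2) (rotJ (deriv Γ s')) = 0 := by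
    intro s' z' hz'; simp only [add_zero, zero_smul]; exact hE1 s' z' _ (hν2 s')
  have hT0 : ∀ s' : ℝ, ∀ z' ∈ Ioo (-ρ) ρ,
      fderiv ℝ (fun y => U (-1 + 0) y 2) (Γ s' + (fun _ : ℝ => (0 : ℝ)) z' • rotJ (deriv Γ s') + z' • e2) (deriv Γ s') = 0 := by
    intro s' z' hz'; simp only [add_zero, zero_smul]; exact hE1 s' z' _ (hT2 s')
  have hμ1' : μ (-1 + 0) z ≠ 1 := by simpa using hμ1.ne
  have hkin' : fderiv ℝ (fderiv ℝ (uncurry fun a y => σ * U (-1 + a) y 2)) ((0 : ℝ), Γ s + (fun _ : ℝ => (0 : ℝ)) z • rotJ (deriv Γ s) + z • e2)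
      ((1 : ℝ), fderiv ℝ n₀ ((0 : ℝ), s, z) ((1 : ℝ), (0 : ℝ), (0 : ℝ)) • rotJ (deriv Γ s)) ((0 : ℝ), rotJ (deriv Γ s)) = 0 := by
    simpa only [zero_smul, add_zero] using hkin
  have hspeed := curved_sheet_speed_law hrate hcont hmild hdiv hpol hμ3 hslabU (τ := 0) (by norm_num) (by simpa using hρ) hΓc2 hΓ2 hΓunit hk
    isOpen_Ioo hIρ (contDiffOn_const (c := (0 : ℝ))) hJ hν0 hT0 s hzI hμ1' hσ hkin'
  simp only [zero_smul, add_zero, mul_zero, sub_zero, one_mul, deriv_const, zero_mul, zero_div] at hspeed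
  obtain ⟨-, hBTT, -, h4, -, h6⟩ := vertical_cylinder_jets hrate hcont hmild hdiv hμ3 hρ hslabU hΓc2 hΓ2 hΓunit hk hcritE s hzρ
  have hsum : fderiv ℝ (fderiv ℝ (fderiv ℝ (fun y => U (-1) y 2))) (Γ s + z • e2) (rotJ (deriv Γ s)) (rotJ (deriv Γ s)) (rotJ (deriv Γ s)) =
      k s * fderiv ℝ (fderiv ℝ (fun y => U (-1) y 2)) (Γ s + z • e2) (rotJ (deriv Γ s)) (rotJ (deriv Γ s)) := by
    have h := (mul_eq_zero.1 h6).resolve_left hμ0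
    linarith [h4]
  rw [hsum] at hspeed
  /- STEP 3: `D²θ[ν,ν] ≠ 0` at the centre (ridge law + `D²θ[T,T] = 0`) -/
  have hB : fderiv ℝ (fderiv ℝ (fun y => U (-1) y 2)) (Γ s + z • e2) (rotJ (deriv Γ s)) (rotJ (deriv Γ s)) ≠ 0 := by
    intro hB0
    rw [fderiv_fderiv_const_mul_apply hθ2, fderiv_fderiv_const_mul_apply hθ2, hBTT, hB0, mul_zero, add_zero] at h8
    linarith
  /- STEP 4: `Uₕ·ν` is `z`-free on the cylinder -/
  have hline : ∀ z' : ℝ, HasDerivAt (fun z'' : ℝ => Γ s + z'' • e2) e2 z' := fun z' => by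
    have h := ((hasDerivAt_id' z').smul_const e2).const_add (Γ s); rw [one_smul] at h; exact h
  have hD : ∀ z' ∈ Ioo (-ρ) ρ, HasDerivAt (fun z'' : ℝ => ⟪U (-1) (Γ s + z'' • e2), rotJ (deriv Γ s)⟫) 0 z' := by
    intro z' hz'
    have hc : HasDerivAt (fun z'' : ℝ => U (-1) (Γ s + z'' • e2)) (fderiv ℝ (U (-1)) (Γ s + z' • e2) e2) z' :=
      (hUd _).hasFDerivAt.comp_hasDerivAt z' (hline z')
    have hi := hc.inner ℝ (hasDerivAt_const z' (rotJ (deriv Γ s)))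
    have h0' : fderiv ℝ (U (-1)) (Γ s + z' • e2) e2 0 = 0 := hE3 s z' (hIρ z' hz') 0 (by decide)
    have h1' : fderiv ℝ (U (-1)) (Γ s + z' • e2) e2 1 = 0 := hE3 s z' (hIρ z' hz') 1 (by decide)
    have hval : ⟪U (-1) (Γ s + z' • e2), (0 : EuclideanSpace ℝ (Fin 3))⟫ + ⟪fderiv ℝ (U (-1)) (Γ s + z' • e2) e2, rotJ (deriv Γ s)⟫ = 0 := by
      rw [inner_zero_right, zero_add]
      simp [PiLp.inner_apply, Fin.sum_univ_three, h0', h1', hν2 s]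
    rw [hval] at hi
    exact hi
  have hconst : ⟪U (-1) (Γ s + z • e2), rotJ (deriv Γ s)⟫ = ⟪U (-1) (Γ s + (0 : ℝ) • e2), rotJ (deriv Γ s)⟫ :=
    isOpen_Ioo.is_const_of_deriv_eq_zero isPreconnected_Ioo (fun z' hz' => (hD z' hz').differentiableAt.differentiableWithinAt)
      (fun z' hz' => (hD z' hz').deriv) hzI ⟨by linarith, hρ⟩
  rw [zero_smul, add_zero] at hconst
  /- STEP 5: conclude -/
  rw [← hconst]
  have hkey : (fderiv ℝ n₀ ((0 : ℝ), s, z) ((1 : ℝ), (0 : ℝ), (0 : ℝ)) - ⟪U (-1) (Γ s + z • e2), rotJ (deriv Γ s)⟫) *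
      fderiv ℝ (fderiv ℝ (fun y => U (-1) y 2)) (Γ s + z • e2) (rotJ (deriv Γ s)) (rotJ (deriv Γ s)) = 0 := by
    linear_combination hspeed
  exact sub_eq_zero.1 ((mul_eq_zero.1 hkey).resolve_right hB)

end Summit.NavierStokesRegularity.NavierStokesRegularity.Theorems.PoloidalWindowDoorLrcModEntireQ4CurvedVerticalWebSpeed

end
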